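import Literature.AlgebraicTopology.Homotopy.MappingTelescope
import Mathlib.Topology.UnitInterval
import HarnessLib

/-!
# The mapping telescope: sliding up one level, and packaging of maps/homotopies on subsets

Topic `Literature/AlgebraicTopology/Homotopy` (sub-namespace `Telescope`), continuing
`MappingTelescope.lean` (Hatcher, *Algebraic Topology* (2002), §3.F and proof of Prop. A.11).
The basic self-homotopy of a mapping telescope `T(f, f, …)`: every point slides up the
telescope at unit speed; after time `1` the point `(x, k + s)` has become `(f x, k + 1 + s)`.
Hence the identity of the telescope is homotopic to the **shift** `(x, k + s) ↦ (f x, k + 1 + s)`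
(Hatcher's fact (2), `T(f₁, f₂, …) ≃ T(f₂, f₃, …)`, in the form used for Prop. A.11).

* `Telescope.mapOfAmbient`, `Telescope.homotopyOfAmbient`: continuous maps / homotopies
  between subsets of ambient spaces from ambient functions continuous on the subset (packaging);
* `Telescope.shift f P`: the shift self-map of the telescope `space f P`;
* `Telescope.slide f`: the sliding homotopy, `Telescope.slideHomotopy : id ≃ shift`.

No `sorry`; [folklore] (Hatcher 2002, p. 528, facts (1)–(3) on telescopes are "elementary").

## References

* A. Hatcher, *Algebraic Topology*, CUP (2002), §3.F p. 312, Appendix p. 528. [HatcherAT2002]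
-/

noncomputable section

open Set Function Topology Filter unitInterval

namespace Literature.AlgebraicTopology.Homotopy

namespace Telescope

/-! ### Packaging maps and homotopies on subsets from ambient data -/

section Ambient

variable {A B : Type*} [TopologicalSpace A] [TopologicalSpace B] {S : Set A} {T : Set B}

/-- A continuous map `S → T` between subsets from an ambient function continuous on `S` and
mapping `S` into `T`. [folklore] -/
def mapOfAmbient (φ : A → B) (hφ : ContinuousOn φ S) (hST : MapsTo φ S T) : C(S, T) :=
  ⟨fun x => ⟨φ x, hST x.2⟩, hφ.restrict.subtype_mk _⟩

/-- `mapOfAmbient` is the ambient function. [folklore] -/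
@[simp]
theorem mapOfAmbient_apply (φ : A → B) (hφ : ContinuousOn φ S) (hST : MapsTo φ S T) (x : S) :
    (mapOfAmbient φ hφ hST x : B) = φ x := rfl

/-- A homotopy between maps `S → T` of subsets from an ambient function `Φ : A × [0, 1] → B`
continuous on `S × [0, 1]`, valued in `T` there, with the prescribed ends. [folklore] -/
def homotopyOfAmbient (f₀ f₁ : C(S, T)) (Φ : A × I → B) (hΦ : ContinuousOn Φ (S ×ˢ univ))
    (hmem : ∀ x ∈ S, ∀ t : I, Φ (x, t) ∈ T) (h0 : ∀ x : S, Φ (x, 0) = f₀ x)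
    (h1 : ∀ x : S, Φ (x, 1) = f₁ x) : ContinuousMap.Homotopy f₀ f₁ where
  toFun q := ⟨Φ (q.2, q.1), hmem _ q.2.2 _⟩
  continuous_toFun := by
    have hc : Continuous fun q : I × S => ((q.2 : A), q.1) :=
      (continuous_subtype_val.comp continuous_snd).prodMk continuous_fst
    exact (hΦ.comp_continuous hc fun q => ⟨q.2.2, mem_univ _⟩).subtype_mk _
  map_zero_left x := Subtype.ext (h0 x)
  map_one_left x := Subtype.ext (h1 x)

end Ambient

variable {E : Type*} [NormedAddCommGroup E] [NormedSpace ℝ E]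

/-! ### The shift -/

/-- Levelwise data of the shift: `(x, k + s) ↦ (f x, k + 1 + s)`. [folklore] -/
def shiftData (f : E → E) (k : ℕ) (x : E) (s : ℝ) : E × E × ℝ := emb f (k + 1) (f x) s

/-- **The shift** of the telescope, as a function on the ambient space:
`emb f k x s ↦ emb f (k + 1) (f x) s`. [folklore] -/
def shift (f : E → E) : E × E × ℝ → E × E × ℝ := lift (shiftData f)

/-- Compatibility of the shift data with the telescope identification. [folklore] -/
theorem shiftData_compat (f : E → E) (k : ℕ) (x : E) :
    shiftData f k x 1 = shiftData f (k + 1) (f x) 0 := by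
  simp only [shiftData, emb_one]

/-- The shift on telescope points. [folklore] -/
theorem shift_emb {f : E → E} {P : Set E} (k : ℕ) {x : E} (hx : x ∈ P) {s : ℝ}
    (hs : s ∈ Icc (0 : ℝ) 1) : shift f (emb f k x s) = emb f (k + 1) (f x) s :=
  lift_emb (P := P) (fun k x _ => shiftData_compat f k x) k hx hs

/-- The shift maps the telescope into itself. [folklore] -/
theorem shift_mapsTo {f : E → E} {P : Set E} (hfP : MapsTo f P P) :
    MapsTo (shift f) (space f P) (space f P) := by
  intro p hp
  obtain ⟨k, x, s, hx, hs, rfl⟩ := exists_rep hfP hp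
  rw [shift_emb k hx (Ico_subset_Icc_self hs)]
  exact emb_mem_space (k + 1) (hfP hx) (Ico_subset_Icc_self hs)

/-- The shift is continuous on the telescope. [folklore] -/
theorem continuousOn_shift {f : E → E} {P : Set E} (hP : IsCompact P) (hf : ContinuousOn f P)
    (hfP : MapsTo f P P) : ContinuousOn (shift f) (space f P) := by
  refine continuousOn_lift hP hf (fun k x _ => shiftData_compat f k x) fun k => ?_
  exact (continuousOn_emb hf (k + 1)).comp (hf.prodMap continuousOn_id)
    fun p hp => ⟨hfP hp.1, mem_univ _⟩

/-- The shift as a continuous self-map of the telescope. [folklore] -/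
def shiftMap {f : E → E} {P : Set E} (hP : IsCompact P) (hf : ContinuousOn f P)
    (hfP : MapsTo f P P) : C(space f P, space f P) :=
  mapOfAmbient (shift f) (continuousOn_shift hP hf hfP) (shift_mapsTo hfP)

/-! ### Sliding up the telescope -/

/-- Levelwise data of the slide by `u ∈ [0, 1]`: the point `(x, k + s)` goes to
`(x, k + s + u)` while `s + u ≤ 1`, and to `(f x, k + s + u)` on the next level beyond.
[folklore] -/
def slideData (f : E → E) (u : ℝ) (k : ℕ) (x : E) (s : ℝ) : E × E × ℝ :=
  if s + u ≤ 1 then emb f k x (s + u) else emb f (k + 1) (f x) (s + u - 1)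

/-- **The slide**: `(p, u) ↦` the telescope point at height `height p + u` above `p`.
[folklore] -/
def slide (f : E → E) (q : (E × E × ℝ) × I) : E × E × ℝ := lift (slideData f q.2) q.1

/-- Compatibility of the slide data with the telescope identification. [folklore] -/
theorem slideData_compat (f : E → E) {u : ℝ} (hu : 0 ≤ u) (hu1 : u ≤ 1) (k : ℕ) (x : E) :
    slideData f u k x 1 = slideData f u (k + 1) (f x) 0 := by
  unfold slideData
  by_cases h : (1 : ℝ) + u ≤ 1
  · have hu0 : u = 0 := le_antisymm (by linarith) hu
    subst hu0
    simp [emb_one]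
  · rw [if_neg h, if_pos (by linarith)]
    congr 1
    ring

/-- The slide on telescope points. [folklore] -/
theorem slide_emb {f : E → E} {P : Set E} (k : ℕ) {x : E} (hx : x ∈ P) {s : ℝ}
    (hs : s ∈ Icc (0 : ℝ) 1) (u : I) :
    slide f (emb f k x s, u) = slideData f u k x s :=
  lift_emb (P := P) (fun k x _ => slideData_compat f u.2.1 u.2.2 k x) k hx hs

/-- The slide stays in the telescope. [folklore] -/
theorem slide_mem {f : E → E} {P : Set E} (hfP : MapsTo f P P) {p : E × E × ℝ}
    (hp : p ∈ space f P) (u : I) : slide f (p, u) ∈ space f P := by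
  obtain ⟨k, x, s, hx, hs, rfl⟩ := exists_rep hfP hp
  rw [slide_emb k hx (Ico_subset_Icc_self hs) u, slideData]
  split_ifs with h
  · exact emb_mem_space k hx ⟨by linarith [hs.1, u.2.1], h⟩
  · exact emb_mem_space (k + 1) (hfP hx) ⟨by linarith, by linarith [hs.2, u.2.2]⟩

/-- The slide is continuous on `telescope × [0, 1]`. [folklore] -/
theorem continuousOn_slide {f : E → E} {P : Set E} (hP : IsCompact P) (hf : ContinuousOn f P)
    (hfP : MapsTo f P P) : ContinuousOn (slide f) (space f P ×ˢ univ) := by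
  refine continuousOn_prod_of_comp_emb hP hf fun k => ?_
  have heq : ∀ q ∈ (P ×ˢ Icc (0 : ℝ) 1) ×ˢ (univ : Set I),
      slide f (emb f k q.1.1 q.1.2, q.2) = slideData f q.2 k q.1.1 q.1.2 :=
    fun q hq => slide_emb k hq.1.1 hq.1.2 q.2
  refine ContinuousOn.congr ?_ heq
  -- the two branches of `slideData`
  have hsum : Continuous fun q : (E × ℝ) × I => q.1.2 + (q.2 : ℝ) := by fun_prop
  refine ContinuousOn.if ?_ ?_ ?_
  · rintro ⟨⟨x, s⟩, u⟩ ⟨-, hfr⟩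
    have h1 : s + (u : ℝ) = 1 := frontier_le_subset_eq hsum continuous_const hfr
    simp only [h1, sub_self]
    rw [emb_one]
  · exact ((continuousOn_emb hf k).comp (continuousOn_fst.fst.prodMk hsum.continuousOn)
      fun q hq => ⟨hq.1.1.1, mem_univ _⟩)
  · exact ((continuousOn_emb hf (k + 1)).comp
      ((hf.comp continuousOn_fst.fst fun q hq => hq.1.1.1).prodMk
        (hsum.continuousOn.sub continuousOn_const))
      fun q hq => ⟨hfP hq.1.1.1, mem_univ _⟩)

/-- At time `0` the slide is the identity. [folklore] -/
theorem slide_zero {f : E → E} {P : Set E} (hfP : MapsTo f P P) {p : E × E × ℝ}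
    (hp : p ∈ space f P) : slide f (p, 0) = p := by
  obtain ⟨k, x, s, hx, hs, rfl⟩ := exists_rep hfP hp
  rw [slide_emb k hx (Ico_subset_Icc_self hs) 0, slideData]
  simp only [Icc.coe_zero, add_zero, if_pos hs.2.le]

/-- At time `1` the slide is the shift. [folklore] -/
theorem slide_one {f : E → E} {P : Set E} (hfP : MapsTo f P P) {p : E × E × ℝ}
    (hp : p ∈ space f P) : slide f (p, 1) = shift f p := by
  obtain ⟨k, x, s, hx, hs, rfl⟩ := exists_rep hfP hp
  rw [slide_emb k hx (Ico_subset_Icc_self hs) 1, shift_emb k hx (Ico_subset_Icc_self hs),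
    slideData]
  simp only [Icc.coe_one]
  split_ifs with h
  · have hs0 : s = 0 := le_antisymm (by linarith) hs.1
    subst hs0
    rw [zero_add, emb_one]
  · congr 1
    ring

/-- **The identity of the telescope is homotopic to the shift** (slide every point up one
level; Hatcher 2002, p. 528, fact (2)). [cite: HatcherAT2002, Appendix p. 528 (telescope facts (1)–(3))] -/
def slideHomotopy {f : E → E} {P : Set E} (hP : IsCompact P) (hf : ContinuousOn f P)
    (hfP : MapsTo f P P) :
    ContinuousMap.Homotopy (ContinuousMap.id (space f P)) (shiftMap hP hf hfP) :=
  homotopyOfAmbient _ _ (slide f) (continuousOn_slide hP hf hfP)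
    (fun _ hp u => slide_mem hfP hp u) (fun p => slide_zero hfP p.2) fun p => slide_one hfP p.2

end Telescope

end Literature.AlgebraicTopology.Homotopy

end
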